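/-
Copyright (c) 2026 the pub-hodgecm-mathlib formalisation cell (harness21).  Prover seat hodgecm-mathlib-F0P3a-p07 (g12), 2026-09-01.  Road «S3-ram» seeding wave (LEAD T11-41; owner F0P3a-p06 (g15)):
organ «(δ) tame-ram twin» sequel (n1a) — the depth-free Φ^st-currency LEVI rows at a TAME-RAMIFIED non-split place.
-/
import Literature.NumberTheory.Rogawski1990.DepthZeroTransferHValuesLeviRamified  -- ★ p846823 (this seat): (δ)-ram heads `classOrbitalIntegral_chiZero_eq_of_torus_deep_ramified` ∕ `…chiOne_eq_zero_of_torus_deep_ramified`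
import Literature.NumberTheory.Rogawski1990.UnitFundamentalLemmaInertLeviClause  -- ★ Levi transport kit: `isLocalGRegular_conj_iff`, `isUnit_levi_of_isLocalGRegular_of_nonsplit`, `isConj_of_isLocalStablyConjH_of_levi`, `cmLocalIntegralLevel_one_eq_top_of_smul_eq`, `isLocalGRegular_out_mk`
import Literature.NumberTheory.Rogawski1990.LocalDeltaTransferLeviStratum        -- ★ one-class socket `stableOrbitalIntegralRel_eq_classOrbitalIntegral_of_unique`
import HarnessLib

/-!
# T3′'s H-side rows at a LEVI `γ_H` at a TAME-RAMIFIED non-split place, depth-free: `Φ^st(γ_H, χ₀) = ν_H(K_H)·J_H`, `Φ^st(γ_H, χ₁) = 0`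

Topic `NumberTheory/Rogawski1990`; namespace `Literature.NumberTheory.Automorphic.UnitaryGroup`.  THEOREMS ONLY (no definition, no instance, no notation, no named fact, no `sorry`).
Cell `pub/hodgecm-mathlib`, crux H413 = `stmt-HodgeConjecture-24833`; road «S3-ram» seeding wave (LEAD F0P3a-plan (g12) T11-41; owner∕table F0P3a-p06 (g15)), organ «(δ) TAME-RAM TWIN»
sequel (n1a): the ramified twin of ★ `DepthZeroTransferHValuesLeviFrame` (p846703) over ★ `DepthZeroTransferHValuesLeviRamified` (p846823); consumer: the S3-ram fold's `stub_rowsRam`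
(Levi population H-side; END pen).  Seat F0P3a-p07 (g12).  HONEST LABEL: HC_CM is proved only modulo the cell's 2 remaining named inputs (hLiu418 24832, h413 24833) until rung 0 closes;
«S3-ram» is Literature seeding with no books consequence; this file is unconditional and discharges nothing by itself.

THE MATHEMATICS ([Rogawski1990] §4.9 p. 55, Prop. 4.9.1 (b); §4.3 (4.3.1) p. 43).  As in ★ p846703 (one `H_v`-class in the Levi stable class ⇒ `Φ^st(γ_H, χ_s) = Φ_H(⟦yγ_Hy⁻¹⟧, χ_s)`, then the
class values), with the TAME-RAMIFIED class values of ★ p846823: `(ν_H(K_H)·J_H(t), 0)` instead of the inert `ν_H(K_H)·J_H(t)·q⁻¹·(1, q − 1)`.  The transport kit (★ `isLocalGRegular_conj_iff`,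
`isUnit_levi_of_isLocalGRegular_of_nonsplit`, `isConj_of_isLocalStablyConjH_of_levi`, `cmLocalIntegralLevel_one_eq_top_of_smul_eq`, `…of_unique`) binds `hw` only, so it ports verbatim.
* `stableOrbitalIntegralRel_chiZero_eq_of_levi_frame_ramified`, `stableOrbitalIntegralRel_chiOne_eq_zero_of_levi_frame_ramified`, `stableOrbitalIntegralRel_chi_combination_of_levi_ramified`
  (frame `hreg y hyd′ ht1`, `hmH : IsCanonical (IsLocalGRegular L v) νH`, `he h2w`, `χdec`s).

## References
* [Rogawski1990] J. D. Rogawski, *Automorphic Representations of Unitary Groups in Three Variables*, Ann. of Math. Stud. 123 (1990), §4.9 p. 54–55, Prop. 4.9.1 (b); §4.3 (4.3.1) p. 43.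
* [Kottwitz1986] R. E. Kottwitz, *Base change for unit elements of Hecke algebras*, Compositio Math. 60 (1986), §3.
* [Serre1979] J.-P. Serre, *Local Fields*, GTM 67 (1979), Ch. I §7–§8.
-/

set_option autoImplicit false

noncomputable section

open MeasureTheory Measure Set Filter Topology NumberField IsDedekindDomain Matrix Polynomial ValuativeRel
open scoped ENNReal NNReal ValuativeRel Matrix MatrixGroups

namespace Literature.NumberTheory.Automorphic.UnitaryGroup

open Literature.NumberTheory.Rogawski1990 Literature.NumberTheory.Automorphic Literature.NumberTheory.Automorphic.IntegralReduction
open Literature.NumberTheory.Automorphic.UnitaryGroup.HeisRing Literature.NumberTheory.Automorphic.UnitaryGroup.LineRing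

section Place

variable (L : Type) [Field L] [NumberField L] [IsCMField L] (v : HeightOneSpectrum (𝓞 ↥(maximalRealSubfield L)))
  (w : PlacesOver L v) (hw : IsCMField.complexConj L • w.1 = w.1)

variable
  [MeasurableSpace ((cmDatum L 2 (Matrix.of fun i j : Fin 2 => if i.val + j.val + 1 = 2 then (1 : L) else 0)).Local v × (cmDatum L 1 (Matrix.of fun i j : Fin 1 => if i.val + j.val + 1 = 1 then (1 : L) else 0)).Local v)] [BorelSpace ((cmDatum L 2 (Matrix.of fun i j : Fin 2 => if i.val + j.val + 1 = 2 then (1 : L) else 0)).Local v × (cmDatum L 1 (Matrix.of fun i j : Fin 1 => if i.val + j.val + 1 = 1 then (1 : L) else 0)).Local v)]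
  [∀ a : (cmDatum L 2 (Matrix.of fun i j : Fin 2 => if i.val + j.val + 1 = 2 then (1 : L) else 0)).Local v × (cmDatum L 1 (Matrix.of fun i j : Fin 1 => if i.val + j.val + 1 = 1 then (1 : L) else 0)).Local v, MeasurableSpace (((cmDatum L 2 (Matrix.of fun i j : Fin 2 => if i.val + j.val + 1 = 2 then (1 : L) else 0)).Local v × (cmDatum L 1 (Matrix.of fun i j : Fin 1 => if i.val + j.val + 1 = 1 then (1 : L) else 0)).Local v) ⧸ Subgroup.centralizer ({a} : Set ((cmDatum L 2 (Matrix.of fun i j : Fin 2 => if i.val + j.val + 1 = 2 then (1 : L) else 0)).Local v × (cmDatum L 1 (Matrix.of fun i j : Fin 1 => if i.val + j.val + 1 = 1 then (1 : L) else 0)).Local v)))]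
  [∀ a : (cmDatum L 2 (Matrix.of fun i j : Fin 2 => if i.val + j.val + 1 = 2 then (1 : L) else 0)).Local v × (cmDatum L 1 (Matrix.of fun i j : Fin 1 => if i.val + j.val + 1 = 1 then (1 : L) else 0)).Local v, BorelSpace (((cmDatum L 2 (Matrix.of fun i j : Fin 2 => if i.val + j.val + 1 = 2 then (1 : L) else 0)).Local v × (cmDatum L 1 (Matrix.of fun i j : Fin 1 => if i.val + j.val + 1 = 1 then (1 : L) else 0)).Local v) ⧸ Subgroup.centralizer ({a} : Set ((cmDatum L 2 (Matrix.of fun i j : Fin 2 => if i.val + j.val + 1 = 2 then (1 : L) else 0)).Local v × (cmDatum L 1 (Matrix.of fun i j : Fin 1 => if i.val + j.val + 1 = 1 then (1 : L) else 0)).Local v)))]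
  (νH : Measure ((cmDatum L 2 (Matrix.of fun i j : Fin 2 => if i.val + j.val + 1 = 2 then (1 : L) else 0)).Local v × (cmDatum L 1 (Matrix.of fun i j : Fin 1 => if i.val + j.val + 1 = 1 then (1 : L) else 0)).Local v)) [νH.IsHaarMeasure] [νH.IsMulRightInvariant]

set_option maxHeartbeats 1600000 in
set_option synthInstance.maxHeartbeats 400000 in
-- instance-term unification on the CM local carriers, as in ★ `DepthZeroTransferHValuesLevi`
include hw in
/-- **LEVI ROW (χ₀) AT A TAME-RAMIFIED PLACE, DEPTH-FREE: `Φ^st(γ_H, χ₀) = ν_H(K_H)·J_H`** for a `G`-regular `γ_H` with a Levi witness `(yγ_Hy⁻¹)₁ = diag(d′)` and `|d′ᵢ,w − 1| < 1` — the ★ L-δ head (p846606)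
transported to `Φ^st` at `γ_H` (one class in the stable class, ★ `isConj_of_isLocalStablyConjH_of_levi` ∕ ★ `…of_unique`), the `J_H = χ⁻(d′₀⁻¹d′₁ − 1)⁻¹` token kept SYMBOLIC with the
unit named by ★ `isUnit_levi_of_isLocalGRegular_of_nonsplit … .2.1` (the same token ★ `levi_prefactor_eq` p846585 outputs). [cite: Rogawski1990, §4.9 Prop. 4.9.1 (b) p. 55; §4.3 (4.3.1) p. 43] [cite: Kottwitz1986, §3] -/
theorem stableOrbitalIntegralRel_chiZero_eq_of_levi_frame_ramified (he : v.asIdeal.ramificationIdx' w.1.asIdeal ≠ 1) (h2w : Valued.v (2 : w.1.adicCompletion L) = 1)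
    {mH : OrbitalMeasureFamily ((cmDatum L 2 (Matrix.of fun i j : Fin 2 => if i.val + j.val + 1 = 2 then (1 : L) else 0)).Local v × (cmDatum L 1 (Matrix.of fun i j : Fin 1 => if i.val + j.val + 1 = 1 then (1 : L) else 0)).Local v)} (hmH : mH.IsCanonical (IsLocalGRegular L v) νH)
    {γH : ((cmDatum L 2 (Matrix.of fun i j : Fin 2 => if i.val + j.val + 1 = 2 then (1 : L) else 0)).Local v × (cmDatum L 1 (Matrix.of fun i j : Fin 1 => if i.val + j.val + 1 = 1 then (1 : L) else 0)).Local v)} (hreg : IsLocalGRegular L v γH)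
    (y : ((cmDatum L 2 (Matrix.of fun i j : Fin 2 => if i.val + j.val + 1 = 2 then (1 : L) else 0)).Local v × (cmDatum L 1 (Matrix.of fun i j : Fin 1 => if i.val + j.val + 1 = 1 then (1 : L) else 0)).Local v)) {d' : Fin 2 → (UnitaryGroup.LocalRing L v)ˣ}
    (hyd' : glDiagonal 2 (UnitaryGroup.LocalRing L v) d' = ((y * γH * y⁻¹).1.val : GL (Fin 2) (UnitaryGroup.LocalRing L v)))
    (ht1 : ∀ i : Fin 2, Valued.v ((((d' i : (UnitaryGroup.LocalRing L v)ˣ) : UnitaryGroup.LocalRing L v) w) - 1) < 1)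
    (χdec : ∀ h : ((cmDatum L 2 (Matrix.of fun i j : Fin 2 => if i.val + j.val + 1 = 2 then (1 : L) else 0)).Local v × (cmDatum L 1 (Matrix.of fun i j : Fin 1 => if i.val + j.val + 1 = 1 then (1 : L) else 0)).Local v), Decidable ((redMat (((h).1.val : GL (Fin 2) (UnitaryGroup.LocalRing L v)).val.map (Pi.evalRingHom (fun w' : PlacesOver L v => w'.1.adicCompletion L) w)) - 1) ^ 2 = 0 ∧ (redMat (((h).1.val : GL (Fin 2) (UnitaryGroup.LocalRing L v)).val.map (Pi.evalRingHom (fun w' : PlacesOver L v => w'.1.adicCompletion L) w)) - 1).rank = 0)) :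
    stableOrbitalIntegralRel (IsLocalStablyConjH L v) mH (((((cmLocalIntegralLevel L 2 (Matrix.of fun i j : Fin 2 => if i.val + j.val + 1 = 2 then (1 : L) else 0) v).prod (cmLocalIntegralLevel L 1 (Matrix.of fun i j : Fin 1 => if i.val + j.val + 1 = 1 then (1 : L) else 0) v)) : Subgroup ((cmDatum L 2 (Matrix.of fun i j : Fin 2 => if i.val + j.val + 1 = 2 then (1 : L) else 0)).Local v × (cmDatum L 1 (Matrix.of fun i j : Fin 1 => if i.val + j.val + 1 = 1 then (1 : L) else 0)).Local v)) : Set ((cmDatum L 2 (Matrix.of fun i j : Fin 2 => if i.val + j.val + 1 = 2 then (1 : L) else 0)).Local v × (cmDatum L 1 (Matrix.of fun i j : Fin 1 => if i.val + j.val + 1 = 1 then (1 : L) else 0)).Local v)).indicator fun h => if (redMat (((h).1.val : GL (Fin 2) (UnitaryGroup.LocalRing L v)).val.map (Pi.evalRingHom (fun w' : PlacesOver L v => w'.1.adicCompletion L) w)) - 1) ^ 2 = 0 ∧ (redMat (((h).1.val : GL (Fin 2) (UnitaryGroup.LocalRing L v)).val.map (Pi.evalRingHom (fun w' : PlacesOver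 L v => w'.1.adicCompletion L) w)) - 1).rank = 0 then (1 : ℂ) else 0) γH =
      (νH.real ((((cmLocalIntegralLevel L 2 (Matrix.of fun i j : Fin 2 => if i.val + j.val + 1 = 2 then (1 : L) else 0) v).prod (cmLocalIntegralLevel L 1 (Matrix.of fun i j : Fin 1 => if i.val + j.val + 1 = 1 then (1 : L) else 0) v)) : Subgroup ((cmDatum L 2 (Matrix.of fun i j : Fin 2 => if i.val + j.val + 1 = 2 then (1 : L) else 0)).Local v × (cmDatum L 1 (Matrix.of fun i j : Fin 1 => if i.val + j.val + 1 = 1 then (1 : L) else 0)).Local v)) : Set ((cmDatum L 2 (Matrix.of fun i j : Fin 2 => if i.val + j.val + 1 = 2 then (1 : L) else 0)).Local v × (cmDatum L 1 (Matrix.of fun i j : Fin 1 => if i.val + j.val + 1 = 1 then (1 : L) else 0)).Local v)) : ℂ) *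
        (((letI : MeasurableSpace (UnitaryGroup.LocalRing L v) := borel _; haveI : BorelSpace (UnitaryGroup.LocalRing L v) := ⟨rfl⟩
          haveI : SecondCountableTopology (UnitaryGroup.LocalRing L v) := secondCountableTopology_localRing (E := L) v
          ((HeisRing.skewModulus (conjLocal L (IsCMField.complexConj L) v) (continuous_conjLocal L (IsCMField.complexConj L) v) (((isUnit_levi_of_isLocalGRegular_of_nonsplit L w hw hyd' ((isLocalGRegular_conj_iff L y γH).2 hreg)).2.1)).unit
            (map_unit_torusScalar_sub_one_two (conjLocal L (IsCMField.complexConj L) v) (cmLocalForm_eq_over L 2 v)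
              (⟨(((y * γH * y⁻¹).1 : (cmDatum L 2 (Matrix.of fun i j : Fin 2 => if i.val + j.val + 1 = 2 then (1 : L) else 0)).Local v) : ↥(unitaryGroupOfForm (conjLocal L (IsCMField.complexConj L) v) (cmLocalForm L 2 v))), ⟨d', hyd'⟩⟩ : ↥(torusU (conjLocal L (IsCMField.complexConj L) v) (cmLocalForm L 2 v))) hyd' (((isUnit_levi_of_isLocalGRegular_of_nonsplit L w hw hyd' ((isLocalGRegular_conj_iff L y γH).2 hreg)).2.1))))⁻¹ : ℝ≥0)) : ℝ≥0) : ℂ) := by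
  haveI : Algebra.IsQuadraticExtension ↥(maximalRealSubfield L) L := IsCMField.isQuadraticExtension L
  -- the Levi representative `γ₁ := y γ_H y⁻¹ = (diag(d′), u₁)`: `G`-regular, twist scalar a unit, `U(Φ₂)`-part regular
  have hconj : IsConj γH (y * γH * y⁻¹) := isConj_iff.2 ⟨y, rfl⟩
  have hreg₁ : IsLocalGRegular L v (y * γH * y⁻¹) := (isLocalGRegular_conj_iff L y γH).2 hreg
  have hb := (isUnit_levi_of_isLocalGRegular_of_nonsplit L w hw hyd' hreg₁).2.1
  have h3 : IsRegularElt ((endoEmbLocal L v (y * γH * y⁻¹)).val : GL (Fin 3) (UnitaryGroup.LocalRing L v)) := hreg₁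
  rw [isRegularElt_iff, coe_endoEmbLocal, charpoly_endoGL] at h3
  have hreg₂ : IsRegularElt ((y * γH * y⁻¹).1.val : GL (Fin 2) (UnitaryGroup.LocalRing L v)) := h3.of_mul_left
  have hK₁ : ∀ x : (cmDatum L 1 (Matrix.of fun i j : Fin 1 => if i.val + j.val + 1 = 1 then (1 : L) else 0)).Local v, x ∈ cmLocalIntegralLevel L 1 (Matrix.of fun i j : Fin 1 => if i.val + j.val + 1 = 1 then (1 : L) else 0) v := fun x => by
    rw [cmLocalIntegralLevel_one_eq_top_of_smul_eq L _ w hw (isUnit_placeForm_antidiagOne (E := L) 1 w.1)]; exact Subgroup.mem_top x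
  -- one `H_v`-class in the stable class of `γ_H`
  have h01 : IsUnit (((d' 0 : (UnitaryGroup.LocalRing L v)ˣ) : UnitaryGroup.LocalRing L v) - d' 1) := by
    have key : ((d' 0 : (UnitaryGroup.LocalRing L v)ˣ) : UnitaryGroup.LocalRing L v) * ((((d' 0)⁻¹ * d' 1 : (UnitaryGroup.LocalRing L v)ˣ) : UnitaryGroup.LocalRing L v) - 1) = ((d' 1 : (UnitaryGroup.LocalRing L v)ˣ) : UnitaryGroup.LocalRing L v) - (d' 0 : (UnitaryGroup.LocalRing L v)ˣ) := by
      rw [mul_sub, mul_one, Units.val_mul, ← mul_assoc, Units.mul_inv, one_mul]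
    have h := (d' 0).isUnit.mul hb
    rw [key, ← neg_sub] at h
    exact (IsUnit.neg_iff _).1 h
  have huniq : ∀ k : ((cmDatum L 2 (Matrix.of fun i j : Fin 2 => if i.val + j.val + 1 = 2 then (1 : L) else 0)).Local v × (cmDatum L 1 (Matrix.of fun i j : Fin 1 => if i.val + j.val + 1 = 1 then (1 : L) else 0)).Local v), IsLocalStablyConjH L v γH k → IsConj γH k := fun k hk =>
    hconj.trans (isConj_of_isLocalStablyConjH_of_levi L hyd' h01
      (IsStablyConjH.trans ((isLocalStablyConjH_of_isConj_and_conj L (y * γH * y⁻¹)).1 _ hconj.symm) hk))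
  rw [stableOrbitalIntegralRel_eq_classOrbitalIntegral_of_unique (IsLocalStablyConjH L v) mH _ γH (isLocalStablyConjH_of_isConj_and_conj L γH).1 huniq,
    ConjClasses.mk_eq_mk_iff_isConj.2 hconj]
  exact classOrbitalIntegral_chiZero_eq_of_torus_deep_ramified L v w hw νH hmH he h2w
    (⟨(y * γH * y⁻¹).1, ⟨d', hyd'⟩⟩ : ↥(cmBorelTriple L 2 v).M) hyd' hb hreg₂ ht1 (y * γH * y⁻¹).2 (isLocalGRegular_out_mk hreg₁) hK₁ χdec

set_option maxHeartbeats 1600000 in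
set_option synthInstance.maxHeartbeats 400000 in
-- instance-term unification on the CM local carriers, as above
include hw in
/-- **LEVI ROW (χ₁) AT A TAME-RAMIFIED PLACE: `Φ^st(γ_H, χ₁) = 0`** (the rank-`1` line stratum is empty, ★ `LineStrataMeasureRamified`). [cite: Rogawski1990, §4.9 Prop. 4.9.1 (b) p. 55; §4.3 (4.3.1) p. 43] [cite: Kottwitz1986, §3] -/
theorem stableOrbitalIntegralRel_chiOne_eq_zero_of_levi_frame_ramified (he : v.asIdeal.ramificationIdx' w.1.asIdeal ≠ 1) (h2w : Valued.v (2 : w.1.adicCompletion L) = 1)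
    {mH : OrbitalMeasureFamily ((cmDatum L 2 (Matrix.of fun i j : Fin 2 => if i.val + j.val + 1 = 2 then (1 : L) else 0)).Local v × (cmDatum L 1 (Matrix.of fun i j : Fin 1 => if i.val + j.val + 1 = 1 then (1 : L) else 0)).Local v)} (hmH : mH.IsCanonical (IsLocalGRegular L v) νH)
    {γH : ((cmDatum L 2 (Matrix.of fun i j : Fin 2 => if i.val + j.val + 1 = 2 then (1 : L) else 0)).Local v × (cmDatum L 1 (Matrix.of fun i j : Fin 1 => if i.val + j.val + 1 = 1 then (1 : L) else 0)).Local v)} (hreg : IsLocalGRegular L v γH)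
    (y : ((cmDatum L 2 (Matrix.of fun i j : Fin 2 => if i.val + j.val + 1 = 2 then (1 : L) else 0)).Local v × (cmDatum L 1 (Matrix.of fun i j : Fin 1 => if i.val + j.val + 1 = 1 then (1 : L) else 0)).Local v)) {d' : Fin 2 → (UnitaryGroup.LocalRing L v)ˣ}
    (hyd' : glDiagonal 2 (UnitaryGroup.LocalRing L v) d' = ((y * γH * y⁻¹).1.val : GL (Fin 2) (UnitaryGroup.LocalRing L v)))
    (ht1 : ∀ i : Fin 2, Valued.v ((((d' i : (UnitaryGroup.LocalRing L v)ˣ) : UnitaryGroup.LocalRing L v) w) - 1) < 1)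
    (χdec : ∀ h : ((cmDatum L 2 (Matrix.of fun i j : Fin 2 => if i.val + j.val + 1 = 2 then (1 : L) else 0)).Local v × (cmDatum L 1 (Matrix.of fun i j : Fin 1 => if i.val + j.val + 1 = 1 then (1 : L) else 0)).Local v), Decidable ((redMat (((h).1.val : GL (Fin 2) (UnitaryGroup.LocalRing L v)).val.map (Pi.evalRingHom (fun w' : PlacesOver L v => w'.1.adicCompletion L) w)) - 1) ^ 2 = 0 ∧ (redMat (((h).1.val : GL (Fin 2) (UnitaryGroup.LocalRing L v)).val.map (Pi.evalRingHom (fun w' : PlacesOver L v => w'.1.adicCompletion L) w)) - 1).rank = 1)) :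
    stableOrbitalIntegralRel (IsLocalStablyConjH L v) mH (((((cmLocalIntegralLevel L 2 (Matrix.of fun i j : Fin 2 => if i.val + j.val + 1 = 2 then (1 : L) else 0) v).prod (cmLocalIntegralLevel L 1 (Matrix.of fun i j : Fin 1 => if i.val + j.val + 1 = 1 then (1 : L) else 0) v)) : Subgroup ((cmDatum L 2 (Matrix.of fun i j : Fin 2 => if i.val + j.val + 1 = 2 then (1 : L) else 0)).Local v × (cmDatum L 1 (Matrix.of fun i j : Fin 1 => if i.val + j.val + 1 = 1 then (1 : L) else 0)).Local v)) : Set ((cmDatum L 2 (Matrix.of fun i j : Fin 2 => if i.val + j.val + 1 = 2 then (1 : L) else 0)).Local v × (cmDatum L 1 (Matrix.of fun i j : Fin 1 => if i.val + j.val + 1 = 1 then (1 : L) else 0)).Local v)).indicator fun h => if (redMat (((h).1.val : GL (Fin 2) (UnitaryGroup.LocalRing L v)).val.map (Pi.evalRingHom (fun w' : PlacesOver L v => w'.1.adicCompletion L) w)) - 1) ^ 2 = 0 ∧ (redMat (((h).1.val : GL (Fin 2) (UnitaryGroup.LocalRing L v)).val.map (Pi.evalRingHom (fun w' : PlacesOver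 L v => w'.1.adicCompletion L) w)) - 1).rank = 1 then (1 : ℂ) else 0) γH = 0 := by
  haveI : Algebra.IsQuadraticExtension ↥(maximalRealSubfield L) L := IsCMField.isQuadraticExtension L
  -- the Levi representative `γ₁ := y γ_H y⁻¹ = (diag(d′), u₁)`: `G`-regular, twist scalar a unit, `U(Φ₂)`-part regular
  have hconj : IsConj γH (y * γH * y⁻¹) := isConj_iff.2 ⟨y, rfl⟩
  have hreg₁ : IsLocalGRegular L v (y * γH * y⁻¹) := (isLocalGRegular_conj_iff L y γH).2 hreg
  have hb := (isUnit_levi_of_isLocalGRegular_of_nonsplit L w hw hyd' hreg₁).2.1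
  have h3 : IsRegularElt ((endoEmbLocal L v (y * γH * y⁻¹)).val : GL (Fin 3) (UnitaryGroup.LocalRing L v)) := hreg₁
  rw [isRegularElt_iff, coe_endoEmbLocal, charpoly_endoGL] at h3
  have hreg₂ : IsRegularElt ((y * γH * y⁻¹).1.val : GL (Fin 2) (UnitaryGroup.LocalRing L v)) := h3.of_mul_left
  have hK₁ : ∀ x : (cmDatum L 1 (Matrix.of fun i j : Fin 1 => if i.val + j.val + 1 = 1 then (1 : L) else 0)).Local v, x ∈ cmLocalIntegralLevel L 1 (Matrix.of fun i j : Fin 1 => if i.val + j.val + 1 = 1 then (1 : L) else 0) v := fun x => by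
    rw [cmLocalIntegralLevel_one_eq_top_of_smul_eq L _ w hw (isUnit_placeForm_antidiagOne (E := L) 1 w.1)]; exact Subgroup.mem_top x
  -- one `H_v`-class in the stable class of `γ_H`
  have h01 : IsUnit (((d' 0 : (UnitaryGroup.LocalRing L v)ˣ) : UnitaryGroup.LocalRing L v) - d' 1) := by
    have key : ((d' 0 : (UnitaryGroup.LocalRing L v)ˣ) : UnitaryGroup.LocalRing L v) * ((((d' 0)⁻¹ * d' 1 : (UnitaryGroup.LocalRing L v)ˣ) : UnitaryGroup.LocalRing L v) - 1) = ((d' 1 : (UnitaryGroup.LocalRing L v)ˣ) : UnitaryGroup.LocalRing L v) - (d' 0 : (UnitaryGroup.LocalRing L v)ˣ) := by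
      rw [mul_sub, mul_one, Units.val_mul, ← mul_assoc, Units.mul_inv, one_mul]
    have h := (d' 0).isUnit.mul hb
    rw [key, ← neg_sub] at h
    exact (IsUnit.neg_iff _).1 h
  have huniq : ∀ k : ((cmDatum L 2 (Matrix.of fun i j : Fin 2 => if i.val + j.val + 1 = 2 then (1 : L) else 0)).Local v × (cmDatum L 1 (Matrix.of fun i j : Fin 1 => if i.val + j.val + 1 = 1 then (1 : L) else 0)).Local v), IsLocalStablyConjH L v γH k → IsConj γH k := fun k hk =>
    hconj.trans (isConj_of_isLocalStablyConjH_of_levi L hyd' h01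
      (IsStablyConjH.trans ((isLocalStablyConjH_of_isConj_and_conj L (y * γH * y⁻¹)).1 _ hconj.symm) hk))
  rw [stableOrbitalIntegralRel_eq_classOrbitalIntegral_of_unique (IsLocalStablyConjH L v) mH _ γH (isLocalStablyConjH_of_isConj_and_conj L γH).1 huniq,
    ConjClasses.mk_eq_mk_iff_isConj.2 hconj]
  exact classOrbitalIntegral_chiOne_eq_zero_of_torus_deep_ramified L v w hw νH hmH he h2w
    (⟨(y * γH * y⁻¹).1, ⟨d', hyd'⟩⟩ : ↥(cmBorelTriple L 2 v).M) hyd' hb hreg₂ ht1 (y * γH * y⁻¹).2 (isLocalGRegular_out_mk hreg₁) hK₁ χdec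

set_option maxHeartbeats 800000 in
include hw in
/-- **THE H-SIDE COMBINATION AT A TAME-RAMIFIED PLACE: `a₀·Φ^st(γ_H, χ₀) + a₁·Φ^st(γ_H, χ₁) = a₀ · ν_H(K_H) · J_H`** at a `G`-regular deep LEVI `γ_H`, ANY `a₀ a₁ : ℂ` — only `a₀` is tested on
the Levi population at a ramified place (inert twin: `a₀ + (q − 1)a₁`, ★ `DepthZeroTransferHValuesLeviFrame`). [cite: Rogawski1990, §4.9 Prop. 4.9.1 (b) p. 55; §4.3 (4.3.1) p. 43] -/
theorem stableOrbitalIntegralRel_chi_combination_of_levi_ramified (he : v.asIdeal.ramificationIdx' w.1.asIdeal ≠ 1) (h2w : Valued.v (2 : w.1.adicCompletion L) = 1)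
    {mH : OrbitalMeasureFamily ((cmDatum L 2 (Matrix.of fun i j : Fin 2 => if i.val + j.val + 1 = 2 then (1 : L) else 0)).Local v × (cmDatum L 1 (Matrix.of fun i j : Fin 1 => if i.val + j.val + 1 = 1 then (1 : L) else 0)).Local v)} (hmH : mH.IsCanonical (IsLocalGRegular L v) νH)
    {γH : ((cmDatum L 2 (Matrix.of fun i j : Fin 2 => if i.val + j.val + 1 = 2 then (1 : L) else 0)).Local v × (cmDatum L 1 (Matrix.of fun i j : Fin 1 => if i.val + j.val + 1 = 1 then (1 : L) else 0)).Local v)} (hreg : IsLocalGRegular L v γH)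
    (y : ((cmDatum L 2 (Matrix.of fun i j : Fin 2 => if i.val + j.val + 1 = 2 then (1 : L) else 0)).Local v × (cmDatum L 1 (Matrix.of fun i j : Fin 1 => if i.val + j.val + 1 = 1 then (1 : L) else 0)).Local v)) {d' : Fin 2 → (UnitaryGroup.LocalRing L v)ˣ}
    (hyd' : glDiagonal 2 (UnitaryGroup.LocalRing L v) d' = ((y * γH * y⁻¹).1.val : GL (Fin 2) (UnitaryGroup.LocalRing L v)))
    (ht1 : ∀ i : Fin 2, Valued.v ((((d' i : (UnitaryGroup.LocalRing L v)ˣ) : UnitaryGroup.LocalRing L v) w) - 1) < 1)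
    (a₀ a₁ : ℂ)
    (χdec₀ : ∀ h : ((cmDatum L 2 (Matrix.of fun i j : Fin 2 => if i.val + j.val + 1 = 2 then (1 : L) else 0)).Local v × (cmDatum L 1 (Matrix.of fun i j : Fin 1 => if i.val + j.val + 1 = 1 then (1 : L) else 0)).Local v), Decidable ((redMat (((h).1.val : GL (Fin 2) (UnitaryGroup.LocalRing L v)).val.map (Pi.evalRingHom (fun w' : PlacesOver L v => w'.1.adicCompletion L) w)) - 1) ^ 2 = 0 ∧ (redMat (((h).1.val : GL (Fin 2) (UnitaryGroup.LocalRing L v)).val.map (Pi.evalRingHom (fun w' : PlacesOver L v => w'.1.adicCompletion L) w)) - 1).rank = 0)) (χdec₁ : ∀ h : ((cmDatum L 2 (Matrix.of fun i j : Fin 2 => if i.val + j.val + 1 = 2 then (1 : L) else 0)).Local v × (cmDatum L 1 (Matrix.of fun i j : Fin 1 => if i.val + j.val + 1 = 1 then (1 : L) else 0)).Local v), Decidable ((redMat (((h).1.val : GL (Fin 2) (UnitaryGroup.LocalRing L v)).val.map (Pi.evalRingHom (fun w' : PlacesOver L v => w'.1.adicCompletion L) w)) - 1) ^ 2 = 0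 ∧ (redMat (((h).1.val : GL (Fin 2) (UnitaryGroup.LocalRing L v)).val.map (Pi.evalRingHom (fun w' : PlacesOver L v => w'.1.adicCompletion L) w)) - 1).rank = 1)) :
    a₀ * stableOrbitalIntegralRel (IsLocalStablyConjH L v) mH (((((cmLocalIntegralLevel L 2 (Matrix.of fun i j : Fin 2 => if i.val + j.val + 1 = 2 then (1 : L) else 0) v).prod (cmLocalIntegralLevel L 1 (Matrix.of fun i j : Fin 1 => if i.val + j.val + 1 = 1 then (1 : L) else 0) v)) : Subgroup ((cmDatum L 2 (Matrix.of fun i j : Fin 2 => if i.val + j.val + 1 = 2 then (1 : L) else 0)).Local v × (cmDatum L 1 (Matrix.of fun i j : Fin 1 => if i.val + j.val + 1 = 1 then (1 : L) else 0)).Local v)) : Set ((cmDatum L 2 (Matrix.of fun i j : Fin 2 => if i.val + j.val + 1 = 2 then (1 : L) else 0)).Local v × (cmDatum L 1 (Matrix.of fun i j : Fin 1 => if i.val + j.val + 1 = 1 then (1 : L) else 0)).Local v)).indicator fun h => if (redMat (((h).1.val : GL (Fin 2) (UnitaryGroup.LocalRing L v)).val.map (Pi.evalRingHom (fun w' : PlacesOver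 L v => w'.1.adicCompletion L) w)) - 1) ^ 2 = 0 ∧ (redMat (((h).1.val : GL (Fin 2) (UnitaryGroup.LocalRing L v)).val.map (Pi.evalRingHom (fun w' : PlacesOver L v => w'.1.adicCompletion L) w)) - 1).rank = 0 then (1 : ℂ) else 0) γH +
        a₁ * stableOrbitalIntegralRel (IsLocalStablyConjH L v) mH (((((cmLocalIntegralLevel L 2 (Matrix.of fun i j : Fin 2 => if i.val + j.val + 1 = 2 then (1 : L) else 0) v).prod (cmLocalIntegralLevel L 1 (Matrix.of fun i j : Fin 1 => if i.val + j.val + 1 = 1 then (1 : L) else 0) v)) : Subgroup ((cmDatum L 2 (Matrix.of fun i j : Fin 2 => if i.val + j.val + 1 = 2 then (1 : L) else 0)).Local v × (cmDatum L 1 (Matrix.of fun i j : Fin 1 => if i.val + j.val + 1 = 1 then (1 : L) else 0)).Local v)) : Set ((cmDatum L 2 (Matrix.of fun i j : Fin 2 => if i.val + j.val + 1 = 2 then (1 : L) else 0)).Local v × (cmDatum L 1 (Matrix.of fun i j : Fin 1 => if i.val + j.val + 1 = 1 then (1 : L) else 0)).Local v)).indicator fun h => if (redMat (((h).1.val : GL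 (Fin 2) (UnitaryGroup.LocalRing L v)).val.map (Pi.evalRingHom (fun w' : PlacesOver L v => w'.1.adicCompletion L) w)) - 1) ^ 2 = 0 ∧ (redMat (((h).1.val : GL (Fin 2) (UnitaryGroup.LocalRing L v)).val.map (Pi.evalRingHom (fun w' : PlacesOver L v => w'.1.adicCompletion L) w)) - 1).rank = 1 then (1 : ℂ) else 0) γH =
      a₀ *
        ((νH.real ((((cmLocalIntegralLevel L 2 (Matrix.of fun i j : Fin 2 => if i.val + j.val + 1 = 2 then (1 : L) else 0) v).prod (cmLocalIntegralLevel L 1 (Matrix.of fun i j : Fin 1 => if i.val + j.val + 1 = 1 then (1 : L) else 0) v)) : Subgroup ((cmDatum L 2 (Matrix.of fun i j : Fin 2 => if i.val + j.val + 1 = 2 then (1 : L) else 0)).Local v × (cmDatum L 1 (Matrix.of fun i j : Fin 1 => if i.val + j.val + 1 = 1 then (1 : L) else 0)).Local v)) : Set ((cmDatum L 2 (Matrix.of fun i j : Fin 2 => if i.val + j.val + 1 = 2 then (1 : L) else 0)).Local v × (cmDatum L 1 (Matrix.of fun i j : Fin 1 => if i.val + j.val + 1 = 1 then (1 : L) else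 0)).Local v)) : ℂ) *
          (((letI : MeasurableSpace (UnitaryGroup.LocalRing L v) := borel _; haveI : BorelSpace (UnitaryGroup.LocalRing L v) := ⟨rfl⟩
          haveI : SecondCountableTopology (UnitaryGroup.LocalRing L v) := secondCountableTopology_localRing (E := L) v
          ((HeisRing.skewModulus (conjLocal L (IsCMField.complexConj L) v) (continuous_conjLocal L (IsCMField.complexConj L) v) (((isUnit_levi_of_isLocalGRegular_of_nonsplit L w hw hyd' ((isLocalGRegular_conj_iff L y γH).2 hreg)).2.1)).unit
            (map_unit_torusScalar_sub_one_two (conjLocal L (IsCMField.complexConj L) v) (cmLocalForm_eq_over L 2 v)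
              (⟨(((y * γH * y⁻¹).1 : (cmDatum L 2 (Matrix.of fun i j : Fin 2 => if i.val + j.val + 1 = 2 then (1 : L) else 0)).Local v) : ↥(unitaryGroupOfForm (conjLocal L (IsCMField.complexConj L) v) (cmLocalForm L 2 v))), ⟨d', hyd'⟩⟩ : ↥(torusU (conjLocal L (IsCMField.complexConj L) v) (cmLocalForm L 2 v))) hyd' (((isUnit_levi_of_isLocalGRegular_of_nonsplit L w hw hyd' ((isLocalGRegular_conj_iff L y γH).2 hreg)).2.1))))⁻¹ : ℝ≥0)) : ℝ≥0) : ℂ)) := by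
  rw [stableOrbitalIntegralRel_chiOne_eq_zero_of_levi_frame_ramified L v w hw νH he h2w hmH hreg y hyd' ht1 χdec₁,
    stableOrbitalIntegralRel_chiZero_eq_of_levi_frame_ramified L v w hw νH he h2w hmH hreg y hyd' ht1 χdec₀]
  ring

end Place

end Literature.NumberTheory.Automorphic.UnitaryGroup

end
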